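import Mathlib
import Summits.ValiantsHypothesis.ValiantsHypothesis.Theorems.OrbitDimensionBound.Negative.ChannelCoveringServedCountStubFalse

/-!
# Line `channel_covering` of crux `OrbitDimensionBound` (stmt-ValiantsHypothesis-16133): audit of the REPAIRED
stub `stub_servedCount` (grades in `ℂˣ`) — exact separation is load-bearing, and the hypotheses are satisfiable

Negative-lane lemmas (val-neg-1, refuter, 2026-08-28) on the re-typed statement C′ of the stub `stub_servedCount`
proposed after its refutation-as-typed (`stub_servedCount_false`, zero grades): C′ is the same statement with the
grades `α β : Fin m → ℂˣ` (memo NOTE-p4g11-16133-channel-retype.md §2).  Everything is inline (no import of the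
`Cruxes/` workfile); `IsGeneric`, `Served`, `chainWt` are unfolded exactly as in `stub_servedCount_false`.

* `stub_servedCount_repaired_false_without_separation` — C′ with clause (iii) of `IsGeneric` (exact separation of
  characters modulo `ℚΛ`) DELETED is false: `n = 4`, `m = 1`, `r = 0`, `d = e ≡ 2`, `α ≡ 1`, `β ≡ 16`; every
  `σ ∈ 𝔖₄` is served by `T = {0, 1}` (`chainWt = 4 · 4 = 16`), clause (ii) holds (`∏ 4^{u_p} = 4^{|u|} ≠ 1`), (i) and the
  admissibility of `Λ` are vacuous, and `C(4,2) = 6 > 4`.  So any proof of C′ must USE (iii) — it is the only clause of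
  `IsGeneric` the card's count (Odlyzko twice + double counting) consumes; (i), (ii) and admissibility are not used by it.
* `stub_servedCount_repaired_hypotheses_satisfiable` — the hypotheses of C′ have a model: `n = 3`, `m = 3`, `r = 0`,
  `(d ; e) = (2, 3, 5 ; 7, 11, 13)`, `α ≡ 1`, `β_i = d₀ e_i`, every `σ` served by `T = {0}` with `i = σ 0`; so C′ is not
  vacuous (its conclusion there reads `3 ≤ 27`).  The zero-grade witness of `stub_servedCount_false` is excluded by the
  typing alone.

Classification: bookkeeping for the planner's re-registration of the line; C′ itself is believed TRUE (size M: labels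
`(i, j)` resp. `(j₁, j₂, |T₁|)`, `≤ 2^r` level pairs per weight class by (iii) + Odlyzko, `⌊n/2⌋! ⌈n/2⌉!` permutations
per pair) and is NOT proved here.  Nothing in this file bears on `OrbitDimensionBound`, `FreeSubtorus` or VP ≠ VNP.
-/

namespace Summit.ValiantsHypothesis.ValiantsHypothesis.Theorems.OrbitDimensionBound.Negative

-- summit = sub-problem name (single-conjunct summit, D-0017 layout), so the namespace repeats it
set_option linter.dupNamespace false

open Finset

/-- **C′ without exact separation is false.**  The repaired `stub_servedCount` (grades in `ℂˣ`) with clause (iii) of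
`IsGeneric` removed fails at `n = 4, m = 1, r = 0, d = e ≡ 2, α ≡ 1, β ≡ 16`: all `24` permutations are served by the
single weight `16 = (2·2)(2·2)` on `T = {0,1}`, while `C(4,2) = 6 > 4 = 1 · (4 · 1) · 4⁰`. [folklore] -/
theorem stub_servedCount_repaired_false_without_separation :
    ¬ (∀ (n m r : ℕ) (Λ : Fin r → (Fin n ⊕ Fin n) → ℤ) (d e : Fin n → ℂˣ) (α β : Fin m → ℂˣ) (s₁ s₂ : Fin m),
        3 ≤ n → (∀ i, (∑ k, Λ i (Sum.inl k)) = 0 ∧ (∑ l, Λ i (Sum.inr l)) = 0) →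
        ((∀ i, (∏ k, (d k) ^ (Λ i (Sum.inl k))) * (∏ l, (e l) ^ (Λ i (Sum.inr l))) = 1) ∧
          (∀ u : Fin n × Fin n → ℕ, u ≠ 0 → (∏ p, ((d p.1 : ℂ) * (e p.2 : ℂ)) ^ (u p)) ≠ 1)) →
        (∀ σ : Equiv.Perm (Fin n),
          (∃ (i j : Fin m) (T : Finset (Fin n)), T.card = n / 2 ∧
              (β i : ℂ) = (∏ k ∈ T, ((d k : ℂ) * (e (σ k) : ℂ))) * (α j : ℂ)) ∨
          (∃ (j₁ j₂ : Fin m) (T₁ T₂ : Finset (Fin n)), Disjoint T₁ T₂ ∧ T₁.card + T₂.card = n / 2 ∧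
              (β s₁ : ℂ) = (∏ k ∈ T₁, ((d k : ℂ) * (e (σ k) : ℂ))) * (α j₁ : ℂ) ∧
              (β s₂ : ℂ) = (∏ k ∈ T₂, ((d k : ℂ) * (e (σ k) : ℂ))) * (α j₂ : ℂ))) →
        Nat.choose n (n / 2) ≤ m * (n * m) * 2 ^ (2 * r)) := by
  intro h
  have key := h 4 1 0 (fun i => Fin.elim0 i) (fun _ => Units.mk0 (2 : ℂ) two_ne_zero)
    (fun _ => Units.mk0 (2 : ℂ) two_ne_zero) (fun _ => 1) (fun _ => Units.mk0 (16 : ℂ) (by norm_num)) 0 0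
    (by norm_num) (fun i => Fin.elim0 i) ⟨fun i => Fin.elim0 i, ?_⟩ ?_
  · -- `C(4,2) = 6 ≤ 4` is absurd
    exact absurd key (by decide)
  · -- clause (ii): `∏_p 4^{u_p}` is an integer `≥ 2`, not `1`
    intro u hu
    have hF : (∏ p : Fin 4 × Fin 4,
        (((Units.mk0 (2 : ℂ) two_ne_zero : ℂˣ) : ℂ) * ((Units.mk0 (2 : ℂ) two_ne_zero : ℂˣ) : ℂ)) ^ u p) =
        ∏ p : Fin 4 × Fin 4, (((4 : ℕ) : ℂ)) ^ u p := by
      refine Finset.prod_congr rfl fun p _ => ?_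
      rw [Units.val_mk0]
      norm_num
    rw [hF]
    exact prod_cast_pow_ne_one (fun _ : Fin 4 × Fin 4 => (4 : ℕ)) (fun _ => by norm_num) u hu
  · -- every permutation is served by `T = {0, 1}` with weight `16`
    intro σ
    refine Or.inl ⟨0, 0, {0, 1}, by decide, ?_⟩
    rw [Finset.prod_const, Units.val_mk0, Units.val_mk0, Units.val_one, mul_one]
    have hc : ({0, 1} : Finset (Fin 4)).card = 2 := by decide
    rw [hc]
    norm_num

/-- **The hypotheses of C′ are satisfiable** (C′ is not vacuous): `n = 3`, `m = 3`, `r = 0`,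
`(d ; e) = (2, 3, 5 ; 7, 11, 13)` (a generic torus point: distinct primes are multiplicatively independent),
`α ≡ 1`, `β_i = d₀ · e_i`, `s₁ = s₂ = 0`; every `σ ∈ 𝔖₃` is served by the one-cell chain `T = {0}` read in row
`i = σ 0`. [folklore] -/
theorem stub_servedCount_repaired_hypotheses_satisfiable :
    ∃ (n m r : ℕ) (Λ : Fin r → (Fin n ⊕ Fin n) → ℤ) (d e : Fin n → ℂˣ) (α β : Fin m → ℂˣ) (s₁ s₂ : Fin m),
        3 ≤ n ∧ (∀ i, (∑ k, Λ i (Sum.inl k)) = 0 ∧ (∑ l, Λ i (Sum.inr l)) = 0) ∧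
        ((∀ i, (∏ k, (d k) ^ (Λ i (Sum.inl k))) * (∏ l, (e l) ^ (Λ i (Sum.inr l))) = 1) ∧
          (∀ u : Fin n × Fin n → ℕ, u ≠ 0 → (∏ p, ((d p.1 : ℂ) * (e p.2 : ℂ)) ^ (u p)) ≠ 1) ∧
          (∀ χ : (Fin n ⊕ Fin n) → ℤ,
            (∏ k, (d k) ^ (χ (Sum.inl k))) * (∏ l, (e l) ^ (χ (Sum.inr l))) = 1 →
            ∃ (N : ℤ) (a : Fin r → ℤ), N ≠ 0 ∧ N • χ = ∑ i, a i • Λ i)) ∧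
        (∀ σ : Equiv.Perm (Fin n),
          (∃ (i j : Fin m) (T : Finset (Fin n)), T.card = n / 2 ∧
              (β i : ℂ) = (∏ k ∈ T, ((d k : ℂ) * (e (σ k) : ℂ))) * (α j : ℂ)) ∨
          (∃ (j₁ j₂ : Fin m) (T₁ T₂ : Finset (Fin n)), Disjoint T₁ T₂ ∧ T₁.card + T₂.card = n / 2 ∧
              (β s₁ : ℂ) = (∏ k ∈ T₁, ((d k : ℂ) * (e (σ k) : ℂ))) * (α j₁ : ℂ) ∧
              (β s₂ : ℂ) = (∏ k ∈ T₂, ((d k : ℂ) * (e (σ k) : ℂ))) * (α j₂ : ℂ))) := by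
  -- the generic torus point: six distinct primes
  let P : Fin 3 ⊕ Fin 3 → ℕ := Sum.elim ![2, 3, 5] ![7, 11, 13]
  have hP : ∀ x, (P x).Prime := by
    intro x
    rcases x with x | x <;> fin_cases x <;> simp [P] <;> norm_num
  have hPinj : Function.Injective P := by decide
  have hP2 : ∀ x, 2 ≤ P x := fun x => (hP x).two_le
  have hP0 : ∀ x, ((P x : ℕ) : ℂ) ≠ 0 := fun x => by exact_mod_cast (hP x).ne_zero
  let U : Fin 3 ⊕ Fin 3 → ℂˣ := fun x => Units.mk0 ((P x : ℕ) : ℂ) (hP0 x)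
  have hU : ∀ x, (U x : ℂ) = (P x : ℂ) := fun x => rfl
  let d : Fin 3 → ℂˣ := fun k => U (Sum.inl k)
  let e : Fin 3 → ℂˣ := fun l => U (Sum.inr l)
  refine ⟨3, 3, 0, fun i => Fin.elim0 i, d, e, fun _ => 1, fun i => d 0 * e i, 0, 0, le_rfl,
    fun i => Fin.elim0 i, ⟨fun i => Fin.elim0 i, ?_, ?_⟩, ?_⟩
  · -- genericity (ii): a non-empty product of the weights `d_k e_l ≥ 14` is not `1`
    intro u hu
    have hw : ∀ p : Fin 3 × Fin 3, ((d p.1 : ℂ) * (e p.2 : ℂ)) = ((P (Sum.inl p.1) * P (Sum.inr p.2) : ℕ) : ℂ) := by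
      intro p
      simp only [d, e, hU, Nat.cast_mul]
    simp_rw [hw]
    exact prod_cast_pow_ne_one (fun p : Fin 3 × Fin 3 => P (Sum.inl p.1) * P (Sum.inr p.2))
      (fun p => le_trans (hP2 _) (Nat.le_mul_of_pos_right _ (hP _).pos)) u hu
  · -- genericity (iii): no character relation at all, so `N = 1`, `a = ()`
    intro χ hχ
    refine ⟨1, fun i => Fin.elim0 i, one_ne_zero, ?_⟩
    have hprod : ∏ x, U x ^ χ x = 1 := by
      rw [Fintype.prod_sum_type]
      exact hχ
    have h0 := eq_zero_of_prod_prime_zpow_eq_one P hP hPinj U hU χ hprod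
    rw [h0, smul_zero, Finset.univ_eq_empty, Finset.sum_empty]
  · -- every permutation is served: row `σ 0`, column `0`, chain `T = {0}`
    intro σ
    refine Or.inl ⟨σ 0, 0, {0}, by decide, ?_⟩
    simp only [Finset.prod_singleton, Units.val_mul, Units.val_one, mul_one]

end Summit.ValiantsHypothesis.ValiantsHypothesis.Theorems.OrbitDimensionBound.Negative
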